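import Summits.ResolutionOfSingularities.ResolutionOfSingularities.Theorems.WeightedInvariantGermContractionIdealSheaf
import Summits.ResolutionOfSingularities.ResolutionOfSingularities.Theorems.WeightedInvariantWeightedChartPrimaryGlobal
import Summits.ResolutionOfSingularities.ResolutionOfSingularities.Theorems.WeightedInvariantWeightedConstructionWeightedChartBasicOpen
import Summits.ResolutionOfSingularities.ResolutionOfSingularities.Theorems.WeightedInvariantWeightedConstructionCobordantBlowupRegular
import Literature.AlgebraicGeometry.Resolution.RegularQuotientIdeal
import HarnessLib

/-!
# On its chart, the centre contracted from a weighted germ filtration IS the weighted chart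

Route `ResolutionOfSingularities/WeightedInvariant`, door crux `HypersurfaceCentreConstruction`
(stmt-ResolutionOfSingularities-19897) — OURS, helper; e-ladder `e = 1`, registered stub `stub_e1_centre` of
`res-L1-w43-stub-10` (cell res-hironaka, `D/res-D-pv-025/DOOR-ELADDER-PLAN.md` §7, sub-lemma **L0-η**).

The centre of rung `e = 1` along an orbit closure `𝒬 = closure {η}` is built from a germ datum at the generic point
`η` (the Abramovich–Quek–Schober germ chart): parameters `u₁, …, uₘ ∈ Γ(Y, U)` on an affine open `U ∋ η` whose
germs lie in `𝔪_η`, weights `wᵢ ≥ 1`, and the Rees algebra `ReesAlgebraData.ofGermFiltration η (n ↦ 𝒥ₙ(germ u))`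
whose pieces are the ideal sheaves CONTRACTED from the germ pieces `𝒥ₙ = (u^α : w·α ≥ n)·𝒪_{Y,η}`
(`germContraction`, file `…GermContractionIdealSheaf`).  This file proves that on the chart `U` the contraction
gives back the chart: **`germContractionIdeal η (𝒥ₙ(germ u)) U = 𝒥ₙ(u) = weightedMonomialIdeal u w n`**, as soon
as, on `U`, the common zeros of the `uᵢ` lie in `closure {η}` and at each of them `𝒪_{Y,y}` is regular with the
`uᵢ` part of a regular system of parameters (the weighted-chart condition).  Consequently
`ofGermFiltration η (𝒥∙(germ u))` HAS THE WEIGHTED CHART `(U, u, w)` (`isWeightedChart_ofGermFiltration`), and its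
support is `closure {η}`.

Proof: the ring-level statement is `under_map_span_weightedMonomials_eq` (file `…WeightedChartPrimaryGlobal`:
the pieces `𝒥ₙ(u) ⊆ A = Γ(Y, U)` are `(u)`-primary, hence contracted from any localisation at a prime over `(u)`),
applied with `S = 𝒪_{Y,η} = A_𝔭`, `𝔭 = 𝔭_η` (`IsAffineOpen.isLocalization_stalk`).  Its two hypotheses are read off
the scheme: (a) `√(u) = 𝔭_η` is prime — every prime `P ⊇ (u)` is the prime of a common zero `y_P ∈ U` of the `uᵢ`,
which lies in `closure {η}`, so `𝔭_η ⊆ P` (a section not vanishing at `y_P` does not vanish at `η`,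
`le_asIdeal_of_fromSpec_mem_closure`); (b) at a maximal `𝔪 ⊇ (u)` the localisation `A_𝔪` is the stalk at `y_𝔪`
(`IsAffineOpen.isLocalization_stalk'`), a regular local ring in which the `uᵢ` have independent differentials, so
they are quasi-regular and generate a prime (`isQuasiRegular_of_linearIndependent_toCotangent`,
`isPrime_span_image_of_linearIndependent_toCotangent`, Matsumura Thms. 14.2, 16.2), transported to
`Localization.AtPrime 𝔪` along `IsLocalization.algEquiv`.

No named facts; pure scheme/commutative-algebra plumbing over the landed ring-level lemmas.
-/

noncomputable section

set_option linter.dupNamespace false -- mandated namespace of this single-conjunct summit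

namespace Summit.ResolutionOfSingularities.ResolutionOfSingularities.Theorems

universe u

open CategoryTheory AlgebraicGeometry TopologicalSpace IsLocalRing Opposite
open Literature.AlgebraicGeometry.Resolution

variable {Y : Scheme.{u}}

/-! ## Points of an affine open, their primes, and vanishing of sections -/

/-- A section vanishes at a point of an affine open (its germ lies in `𝔪_y`) iff it lies in the prime of that
point. [folklore] -/
theorem germ_mem_maximalIdeal_iff_mem_primeIdealOf (U : Y.affineOpens) {y : Y} (hy : y ∈ (U : Y.Opens))
    (s : Γ(Y, U)) :
    (Y.presheaf.germ (U : Y.Opens) y hy).hom s ∈ maximalIdeal (Y.presheaf.stalk y) ↔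
      s ∈ (U.2.primeIdealOf ⟨y, hy⟩).asIdeal := by
  letI : Algebra Γ(Y, U) (Y.presheaf.stalk y) := TopCat.Presheaf.algebra_section_stalk Y.presheaf ⟨y, hy⟩
  have hloc : IsLocalization.AtPrime (Y.presheaf.stalk y) (U.2.primeIdealOf ⟨y, hy⟩).asIdeal :=
    U.2.isLocalization_stalk ⟨y, hy⟩
  exact IsLocalization.AtPrime.to_map_mem_maximal_iff (Y.presheaf.stalk y)
    (U.2.primeIdealOf ⟨y, hy⟩).asIdeal s

/-- A section vanishes at the point `fromSpec P` of an affine open iff it lies in `P`. [folklore] -/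
theorem germ_fromSpec_mem_maximalIdeal_iff (U : Y.affineOpens) (P : PrimeSpectrum Γ(Y, U))
    (hP : U.2.fromSpec.base P ∈ (U : Y.Opens)) (s : Γ(Y, U)) :
    (Y.presheaf.germ (U : Y.Opens) _ hP).hom s ∈ maximalIdeal (Y.presheaf.stalk (U.2.fromSpec.base P)) ↔
      s ∈ P.asIdeal := by
  letI : Algebra Γ(Y, U) (Y.presheaf.stalk (U.2.fromSpec.base P)) :=
    TopCat.Presheaf.algebra_section_stalk Y.presheaf ⟨U.2.fromSpec.base P, hP⟩
  have hloc : IsLocalization.AtPrime (Y.presheaf.stalk (U.2.fromSpec.base P)) P.asIdeal :=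
    U.2.isLocalization_stalk' P hP
  exact IsLocalization.AtPrime.to_map_mem_maximal_iff (Y.presheaf.stalk (U.2.fromSpec.base P)) P.asIdeal s

/-- **Specialisation read on primes.**  If the point `fromSpec P` of the affine open `U` lies in the closure of
`η ∈ U`, then the prime of `η` is contained in `P`: a section `g ∉ P` is a unit at `fromSpec P`, so the open
`D(g)` meets `closure {η}`, hence contains `η`, and `g` is a unit at `η`. [folklore] -/
theorem le_asIdeal_of_fromSpec_mem_closure (U : Y.affineOpens) {η : Y} (hηU : η ∈ (U : Y.Opens))
    (P : PrimeSpectrum Γ(Y, U)) (hP : U.2.fromSpec.base P ∈ closure ({η} : Set Y)) :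
    (U.2.primeIdealOf ⟨η, hηU⟩).asIdeal ≤ P.asIdeal := by
  intro g hg
  by_contra hgP
  have hyU : U.2.fromSpec.base P ∈ (U : Y.Opens) := U.2.range_fromSpec.le ⟨P, rfl⟩
  letI : Algebra Γ(Y, U) (Y.presheaf.stalk (U.2.fromSpec.base P)) :=
    TopCat.Presheaf.algebra_section_stalk Y.presheaf ⟨U.2.fromSpec.base P, hyU⟩
  have hloc : IsLocalization.AtPrime (Y.presheaf.stalk (U.2.fromSpec.base P)) P.asIdeal :=
    U.2.isLocalization_stalk' P hyU
  -- `g` is a unit at `fromSpec P`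
  have hunit : IsUnit ((Y.presheaf.germ (U : Y.Opens) _ hyU).hom g) :=
    (IsLocalization.AtPrime.isUnit_to_map_iff (Y.presheaf.stalk (U.2.fromSpec.base P)) P.asIdeal g).mpr hgP
  have hyD : U.2.fromSpec.base P ∈ Y.basicOpen g := (Y.mem_basicOpen g _ hyU).mpr hunit
  -- hence `η ∈ D(g)`
  obtain ⟨z, hzD, hzη⟩ := mem_closure_iff.mp hP (Y.basicOpen g) (Y.basicOpen g).isOpen hyD
  rw [Set.mem_singleton_iff] at hzη
  subst hzη
  have hunitη : IsUnit ((Y.presheaf.germ (U : Y.Opens) _ hηU).hom g) := (Y.mem_basicOpen g _ hηU).mp hzD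
  -- but `g ∈ 𝔭_η` vanishes at `η`
  have hmem := (germ_mem_maximalIdeal_iff_mem_primeIdealOf U hηU g).mpr hg
  exact (mem_maximalIdeal _).mp hmem hunitη

/-! ## The radical of the parameter ideal is the prime of the generic point -/

variable (U : Y.affineOpens) {m : ℕ} (u : Fin m → Γ(Y, U)) (w : Fin m → ℕ) {η : Y}
  (hηU : η ∈ (U : Y.Opens))

/-- **`√(u) = 𝔭_η`**: if the `uᵢ` vanish at `η ∈ U` and every common zero of the `uᵢ` on `U` lies in
`closure {η}`, then the radical of `(u₁, …, uₘ) ⊆ Γ(Y, U)` is the prime ideal of `η`. [folklore] -/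
theorem radical_span_eq_primeIdealOf
    (hvan : ∀ i, (Y.presheaf.germ (U : Y.Opens) η hηU).hom (u i) ∈ maximalIdeal (Y.presheaf.stalk η))
    (hcl : ∀ (y : Y) (hy : y ∈ (U : Y.Opens)),
      (∀ i, (Y.presheaf.germ (U : Y.Opens) y hy).hom (u i) ∈ maximalIdeal (Y.presheaf.stalk y)) →
      y ∈ closure ({η} : Set Y)) :
    (Ideal.span (Set.range u)).radical = (U.2.primeIdealOf ⟨η, hηU⟩).asIdeal := by
  have hle : Ideal.span (Set.range u) ≤ (U.2.primeIdealOf ⟨η, hηU⟩).asIdeal :=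
    Ideal.span_le.mpr (Set.range_subset_iff.mpr fun i =>
      (germ_mem_maximalIdeal_iff_mem_primeIdealOf U hηU (u i)).mp (hvan i))
  refine le_antisymm ((Ideal.IsPrime.radical_le_iff inferInstance).mpr hle) ?_
  intro g hg
  rw [Ideal.radical_eq_sInf, Submodule.mem_sInf]
  rintro J ⟨hIJ, hJ⟩
  -- the common zero `y_J = fromSpec J` of the `uᵢ` lies in `closure {η}`
  have hyU : U.2.fromSpec.base ⟨J, hJ⟩ ∈ (U : Y.Opens) := U.2.range_fromSpec.le ⟨_, rfl⟩
  have hzero : ∀ i, (Y.presheaf.germ (U : Y.Opens) _ hyU).hom (u i) ∈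
      maximalIdeal (Y.presheaf.stalk (U.2.fromSpec.base ⟨J, hJ⟩)) := fun i =>
    (germ_fromSpec_mem_maximalIdeal_iff U ⟨J, hJ⟩ hyU (u i)).mpr (hIJ (Ideal.subset_span ⟨i, rfl⟩))
  exact le_asIdeal_of_fromSpec_mem_closure U hηU ⟨J, hJ⟩ (hcl _ hyU hzero) hg

/-- Hence `√(u)` is prime. [folklore] -/
theorem isPrime_radical_span
    (hvan : ∀ i, (Y.presheaf.germ (U : Y.Opens) η hηU).hom (u i) ∈ maximalIdeal (Y.presheaf.stalk η))
    (hcl : ∀ (y : Y) (hy : y ∈ (U : Y.Opens)),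
      (∀ i, (Y.presheaf.germ (U : Y.Opens) y hy).hom (u i) ∈ maximalIdeal (Y.presheaf.stalk y)) →
      y ∈ closure ({η} : Set Y)) :
    (Ideal.span (Set.range u)).radical.IsPrime := by
  rw [radical_span_eq_primeIdealOf U u hηU hvan hcl]
  infer_instance

/-! ## Quasi-regularity and primeness at the maximal ideals, from the stalks -/

/-- **The chart condition, read in the localisations at maximal ideals.**  If at every common zero `y ∈ U` of
the `uᵢ` the local ring `𝒪_{Y,y}` is regular and the `uᵢ` have linearly independent differentials, then for every
maximal ideal `𝔪 ⊇ (u)` of `A = Γ(Y, U)` the family `u` is quasi-regular in `A_𝔪` and `(u)A_𝔪` is prime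
(`A_𝔪 ≅ 𝒪_{Y,y_𝔪}`, Matsumura Thms. 14.2, 16.2). [folklore] -/
theorem isQuasiRegular_and_isPrime_localization_of_stalks
    (hreg : ∀ (y : Y) (hy : y ∈ (U : Y.Opens)),
      (∀ i, (Y.presheaf.germ (U : Y.Opens) y hy).hom (u i) ∈ maximalIdeal (Y.presheaf.stalk y)) →
      IsRegularLocalRing (Y.presheaf.stalk y))
    (hli : ∀ (y : Y) (hy : y ∈ (U : Y.Opens))
      (h : ∀ i, (Y.presheaf.germ (U : Y.Opens) y hy).hom (u i) ∈ maximalIdeal (Y.presheaf.stalk y)),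
      LinearIndependent (ResidueField (Y.presheaf.stalk y))
        (fun i => (maximalIdeal (Y.presheaf.stalk y)).toCotangent ⟨_, h i⟩))
    (P : Ideal Γ(Y, U)) [P.IsMaximal] (hP : Ideal.span (Set.range u) ≤ P) :
    IsQuasiRegular (algebraMap Γ(Y, U) (Localization.AtPrime P) ∘ u) ∧
      ((Ideal.span (Set.range u)).map (algebraMap Γ(Y, U) (Localization.AtPrime P))).IsPrime := by
  have hPp : P.IsPrime := Ideal.IsMaximal.isPrime ‹_›
  -- the point `y_P` and its stalk, a localisation of `Γ(Y, U)` at `P`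
  obtain ⟨y, hyU, hloc⟩ : ∃ (y : Y) (hy : y ∈ (U : Y.Opens)),
      @IsLocalization.AtPrime Γ(Y, U) _ (Y.presheaf.stalk y) _
        (TopCat.Presheaf.algebra_section_stalk Y.presheaf ⟨y, hy⟩) P _ :=
    ⟨_, U.2.range_fromSpec.le ⟨_, rfl⟩, U.2.isLocalization_stalk' ⟨P, hPp⟩ (U.2.range_fromSpec.le ⟨_, rfl⟩)⟩
  letI : Algebra Γ(Y, U) (Y.presheaf.stalk y) := TopCat.Presheaf.algebra_section_stalk Y.presheaf ⟨y, hyU⟩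
  have hmem : ∀ i, (Y.presheaf.germ (U : Y.Opens) y hyU).hom (u i) ∈ maximalIdeal (Y.presheaf.stalk y) :=
    fun i => (IsLocalization.AtPrime.to_map_mem_maximal_iff (Y.presheaf.stalk y) P (u i)).mpr
      (hP (Ideal.subset_span ⟨i, rfl⟩))
  haveI : IsRegularLocalRing (Y.presheaf.stalk y) := hreg y hyU hmem
  have hQR : IsQuasiRegular (fun i => (Y.presheaf.germ (U : Y.Opens) y hyU).hom (u i)) :=
    isQuasiRegular_of_linearIndependent_toCotangent _ hmem (hli y hyU hmem)
  have hprime : (Ideal.span (Set.range fun i => (Y.presheaf.germ (U : Y.Opens) y hyU).hom (u i))).IsPrime := by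
    rw [← Set.image_univ]
    exact isPrime_span_image_of_linearIndependent_toCotangent _ hmem (hli y hyU hmem) Set.univ
  -- transport along `𝒪_{Y,y} ≃ₐ Localization.AtPrime P`
  let e : Y.presheaf.stalk y ≃ₐ[Γ(Y, U)] Localization.AtPrime P :=
    IsLocalization.algEquiv P.primeCompl (Y.presheaf.stalk y) (Localization.AtPrime P)
  have hφ : (e : Y.presheaf.stalk y →+* Localization.AtPrime P).comp
      (algebraMap Γ(Y, U) (Y.presheaf.stalk y)) = algebraMap Γ(Y, U) (Localization.AtPrime P) :=
    e.toAlgHom.comp_algebraMap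
  have hcomp : (⇑e.toRingEquiv ∘ fun i => (Y.presheaf.germ (U : Y.Opens) y hyU).hom (u i)) =
      ⇑(algebraMap Γ(Y, U) (Localization.AtPrime P)) ∘ u := by
    funext i
    simp only [Function.comp_apply]
    exact e.commutes (u i)
  refine ⟨?_, ?_⟩
  · have := IsQuasiRegular.map_of_ringEquiv e.toRingEquiv hQR
    rwa [hcomp] at this
  · have hspan : Ideal.span (Set.range fun i => (Y.presheaf.germ (U : Y.Opens) y hyU).hom (u i)) =
        (Ideal.span (Set.range u)).map (algebraMap Γ(Y, U) (Y.presheaf.stalk y)) :=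
      span_range_comp_eq_map (algebraMap Γ(Y, U) (Y.presheaf.stalk y)) u
    haveI := hprime
    have h2 : (Ideal.map (e : Y.presheaf.stalk y →+* Localization.AtPrime P)
        (Ideal.span (Set.range fun i => (Y.presheaf.germ (U : Y.Opens) y hyU).hom (u i)))).IsPrime :=
      Ideal.map_isPrime_of_equiv e
    rwa [hspan, Ideal.map_map, hφ] at h2

/-! ## The contraction of the germ pieces on the chart is the chart -/

/-- **L0-η: on its chart, the germ contraction IS the weighted chart.**  Let `u₁, …, uₘ ∈ Γ(Y, U)` vanish at
`η ∈ U`, with weights `wᵢ ≥ 1`; assume every common zero `y ∈ U` of the `uᵢ` lies in `closure {η}`, with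
`𝒪_{Y,y}` regular and the `uᵢ` part of a regular system of parameters at `y`.  Then for every `n` the ideal of
`Γ(Y, U)` contracted from the germ piece `𝒥ₙ(germ u) = (u^α : w·α ≥ n)·𝒪_{Y,η}` is the chart piece
`𝒥ₙ(u) = weightedMonomialIdeal u w n`. [folklore] -/
theorem germContractionIdeal_weightedMonomialIdeal_germ_eq (hw : ∀ i, 0 < w i)
    (hvan : ∀ i, (Y.presheaf.germ (U : Y.Opens) η hηU).hom (u i) ∈ maximalIdeal (Y.presheaf.stalk η))
    (hcl : ∀ (y : Y) (hy : y ∈ (U : Y.Opens)),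
      (∀ i, (Y.presheaf.germ (U : Y.Opens) y hy).hom (u i) ∈ maximalIdeal (Y.presheaf.stalk y)) →
      y ∈ closure ({η} : Set Y))
    (hreg : ∀ (y : Y) (hy : y ∈ (U : Y.Opens)),
      (∀ i, (Y.presheaf.germ (U : Y.Opens) y hy).hom (u i) ∈ maximalIdeal (Y.presheaf.stalk y)) →
      IsRegularLocalRing (Y.presheaf.stalk y))
    (hli : ∀ (y : Y) (hy : y ∈ (U : Y.Opens))
      (h : ∀ i, (Y.presheaf.germ (U : Y.Opens) y hy).hom (u i) ∈ maximalIdeal (Y.presheaf.stalk y)),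
      LinearIndependent (ResidueField (Y.presheaf.stalk y))
        (fun i => (maximalIdeal (Y.presheaf.stalk y)).toCotangent ⟨_, h i⟩))
    (n : ℕ) :
    germContractionIdeal η
        (weightedMonomialIdeal (fun i => (Y.presheaf.germ (U : Y.Opens) η hηU).hom (u i)) w n) U =
      weightedMonomialIdeal u w n := by
  rcases Nat.eq_zero_or_pos n with rfl | hn
  · rw [weightedMonomialIdeal_zero, weightedMonomialIdeal_zero, germContractionIdeal_top]
  letI : Algebra Γ(Y, U) (Y.presheaf.stalk η) := TopCat.Presheaf.algebra_section_stalk Y.presheaf ⟨η, hηU⟩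
  have hloc : IsLocalization.AtPrime (Y.presheaf.stalk η) (U.2.primeIdealOf ⟨η, hηU⟩).asIdeal :=
    U.2.isLocalization_stalk ⟨η, hηU⟩
  have hφ : (Y.presheaf.germ (U : Y.Opens) η hηU).hom = algebraMap Γ(Y, U) (Y.presheaf.stalk η) := rfl
  rw [germContractionIdeal_of_mem η _ hηU, ← weightedMonomialIdeal_map,
    weightedMonomialIdeal_eq_span_weightedMonomials, hφ]
  have hle : Ideal.span (Set.range u) ≤ (U.2.primeIdealOf ⟨η, hηU⟩).asIdeal :=
    Ideal.span_le.mpr (Set.range_subset_iff.mpr fun i =>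
      (germ_mem_maximalIdeal_iff_mem_primeIdealOf U hηU (u i)).mp (hvan i))
  exact under_map_span_weightedMonomials_eq u w hw hn (isPrime_radical_span U u hηU hvan hcl)
    (fun P _ hP => isQuasiRegular_and_isPrime_localization_of_stalks U u hreg hli P hP)
    (U.2.primeIdealOf ⟨η, hηU⟩).asIdeal hle (Y.presheaf.stalk η)

/-- The same on every affine `U′ ≤ U` (both sides restrict: ideal sheaf data). [folklore] -/
theorem germContraction_weightedMonomialIdeal_germ_ideal_eq_of_le (hw : ∀ i, 0 < w i)
    (hvan : ∀ i, (Y.presheaf.germ (U : Y.Opens) η hηU).hom (u i) ∈ maximalIdeal (Y.presheaf.stalk η))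
    (hcl : ∀ (y : Y) (hy : y ∈ (U : Y.Opens)),
      (∀ i, (Y.presheaf.germ (U : Y.Opens) y hy).hom (u i) ∈ maximalIdeal (Y.presheaf.stalk y)) →
      y ∈ closure ({η} : Set Y))
    (hreg : ∀ (y : Y) (hy : y ∈ (U : Y.Opens)),
      (∀ i, (Y.presheaf.germ (U : Y.Opens) y hy).hom (u i) ∈ maximalIdeal (Y.presheaf.stalk y)) →
      IsRegularLocalRing (Y.presheaf.stalk y))
    (hli : ∀ (y : Y) (hy : y ∈ (U : Y.Opens))
      (h : ∀ i, (Y.presheaf.germ (U : Y.Opens) y hy).hom (u i) ∈ maximalIdeal (Y.presheaf.stalk y)),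
      LinearIndependent (ResidueField (Y.presheaf.stalk y))
        (fun i => (maximalIdeal (Y.presheaf.stalk y)).toCotangent ⟨_, h i⟩))
    (n : ℕ) (hI : ∃ N : ℕ, maximalIdeal (Y.presheaf.stalk η) ^ N ≤
      weightedMonomialIdeal (fun i => (Y.presheaf.germ (U : Y.Opens) η hηU).hom (u i)) w n)
    (U' : Y.affineOpens) (hU' : U' ≤ U) :
    (germContraction η
        (weightedMonomialIdeal (fun i => (Y.presheaf.germ (U : Y.Opens) η hηU).hom (u i)) w n) hI).ideal U' =
      weightedMonomialIdeal (fun i => (Y.presheaf.map (homOfLE hU').op).hom (u i)) w n := by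
  rw [← (germContraction η _ hI).map_ideal hU', germContraction_ideal,
    germContractionIdeal_weightedMonomialIdeal_germ_eq U u w hηU hw hvan hcl hreg hli n, weightedMonomialIdeal_map]

/-! ## The contracted Rees algebra has the chart, and its support is the orbit closure -/

/-- If the generators lie in `𝔪` and **span** it, the weighted monomial ideals are `𝔪`-primary in the strong
sense `𝔪ⁿ ⊆ 𝒥ₙ`. [folklore] -/
theorem maximalIdeal_pow_le_weightedMonomialIdeal {A : Type*} [CommRing A] [IsLocalRing A] {m : ℕ}
    (x : Fin m → A) (w : Fin m → ℕ) (hw : ∀ i, 0 < w i)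
    (hspan : Ideal.span (Set.range x) = maximalIdeal A) (n : ℕ) :
    maximalIdeal A ^ n ≤ weightedMonomialIdeal x w n := by
  rw [← hspan, weightedMonomialIdeal_eq_span_weightedMonomials]
  exact span_pow_le_span_weightedMonomials x w hw le_rfl

/-- For `n ≥ 1` the weighted monomial ideal lies in the ideal of the generators; in particular it is proper
when the generators lie in a proper ideal. [folklore] -/
theorem weightedMonomialIdeal_ne_top_of_le {A : Type*} [CommRing A] {m : ℕ} (x : Fin m → A) (w : Fin m → ℕ)
    {M : Ideal A} (hM : M ≠ ⊤) (hx : ∀ i, x i ∈ M) {n : ℕ} (hn : 0 < n) :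
    weightedMonomialIdeal x w n ≠ ⊤ := by
  intro htop
  apply hM
  rw [eq_top_iff, ← htop, weightedMonomialIdeal_eq_span_weightedMonomials]
  refine (span_weightedMonomials_le_span x w hn).trans ?_
  exact Ideal.span_le.mpr (Set.range_subset_iff.mpr hx)

/-- **The Rees algebra contracted from the weighted germ filtration has the weighted chart `(U, u, w)`.**
[folklore] -/
theorem isWeightedChart_ofGermFiltration (hw : ∀ i, 0 < w i)
    (hvan : ∀ i, (Y.presheaf.germ (U : Y.Opens) η hηU).hom (u i) ∈ maximalIdeal (Y.presheaf.stalk η))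
    (hcl : ∀ (y : Y) (hy : y ∈ (U : Y.Opens)),
      (∀ i, (Y.presheaf.germ (U : Y.Opens) y hy).hom (u i) ∈ maximalIdeal (Y.presheaf.stalk y)) →
      y ∈ closure ({η} : Set Y))
    (hreg : ∀ (y : Y) (hy : y ∈ (U : Y.Opens)),
      (∀ i, (Y.presheaf.germ (U : Y.Opens) y hy).hom (u i) ∈ maximalIdeal (Y.presheaf.stalk y)) →
      IsRegularLocalRing (Y.presheaf.stalk y))
    (hli : ∀ (y : Y) (hy : y ∈ (U : Y.Opens))
      (h : ∀ i, (Y.presheaf.germ (U : Y.Opens) y hy).hom (u i) ∈ maximalIdeal (Y.presheaf.stalk y)),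
      LinearIndependent (ResidueField (Y.presheaf.stalk y))
        (fun i => (maximalIdeal (Y.presheaf.stalk y)).toCotangent ⟨_, h i⟩))
    (h0 : weightedMonomialIdeal (fun i => (Y.presheaf.germ (U : Y.Opens) η hηU).hom (u i)) w 0 = ⊤)
    (hmul : ∀ a b, weightedMonomialIdeal (fun i => (Y.presheaf.germ (U : Y.Opens) η hηU).hom (u i)) w a *
        weightedMonomialIdeal (fun i => (Y.presheaf.germ (U : Y.Opens) η hηU).hom (u i)) w b ≤
      weightedMonomialIdeal (fun i => (Y.presheaf.germ (U : Y.Opens) η hηU).hom (u i)) w (a + b))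
    (hprim : ∀ n, ∃ N : ℕ, maximalIdeal (Y.presheaf.stalk η) ^ N ≤
      weightedMonomialIdeal (fun i => (Y.presheaf.germ (U : Y.Opens) η hηU).hom (u i)) w n) :
    (ReesAlgebraData.ofGermFiltration η
        (fun n => weightedMonomialIdeal (fun i => (Y.presheaf.germ (U : Y.Opens) η hηU).hom (u i)) w n)
        h0 hmul hprim).IsWeightedChart U u w where
  w_pos := hw
  ideal_eq n := by
    change germContractionIdeal η _ U = _
    exact germContractionIdeal_weightedMonomialIdeal_germ_eq U u w hηU hw hvan hcl hreg hli n
  linearIndependent := hli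

/-- **… and its support is `closure {η}`.** [folklore] -/
theorem support_ofGermFiltration_weightedMonomialIdeal
    (hvan : ∀ i, (Y.presheaf.germ (U : Y.Opens) η hηU).hom (u i) ∈ maximalIdeal (Y.presheaf.stalk η))
    (h0 : weightedMonomialIdeal (fun i => (Y.presheaf.germ (U : Y.Opens) η hηU).hom (u i)) w 0 = ⊤)
    (hmul : ∀ a b, weightedMonomialIdeal (fun i => (Y.presheaf.germ (U : Y.Opens) η hηU).hom (u i)) w a *
        weightedMonomialIdeal (fun i => (Y.presheaf.germ (U : Y.Opens) η hηU).hom (u i)) w b ≤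
      weightedMonomialIdeal (fun i => (Y.presheaf.germ (U : Y.Opens) η hηU).hom (u i)) w (a + b))
    (hprim : ∀ n, ∃ N : ℕ, maximalIdeal (Y.presheaf.stalk η) ^ N ≤
      weightedMonomialIdeal (fun i => (Y.presheaf.germ (U : Y.Opens) η hηU).hom (u i)) w n) :
    (ReesAlgebraData.ofGermFiltration η
        (fun n => weightedMonomialIdeal (fun i => (Y.presheaf.germ (U : Y.Opens) η hηU).hom (u i)) w n)
        h0 hmul hprim).support = closure {η} :=
  support_ofGermFiltration η _ h0 hmul hprim fun _ hn =>
    weightedMonomialIdeal_ne_top_of_le _ w (maximalIdeal.isMaximal _).ne_top hvan hn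

end Summit.ResolutionOfSingularities.ResolutionOfSingularities.Theorems

end
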